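import Summits.CriticalPhenomena.PercolationContinuityZ3.Theorems.Transplant.PyrochloreSignQuasiChart
import HarnessLib

/-!
# Pyrochlore-bond, II — the UNROTATED unit chart `(p₀, p₁)`: 1-Lipschitz, all four unit steps along SINGLE bonds at every site, `−I` at every site,
# and a z-GLIDE acting by chart translation that halves the frame types: pyrochlore is a TWO-type `{±1}` carrier at scale `N = 1` (kernel placement
# certificate for the open multi-type `{±1}` node u2; (κ) not typed — nothing claimed about any node)

builds on p205010 (kernel theorem, internal audit signed; external expert review pending) — nothing in this file uses p205010; NOTHING is claimed about
`θ_{pyrochlore}(p_c)` nor about any node (u2 = `SamePDropOfSkeletonNeg` is OPEN).  Lane `prim-bschramm`, seat `prim-bschramm-p4` (gen 21; PART C3,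
`HOME/bschramm/P4-GENERAL.md` §43.2b).  Helper file (`--supports stmt-CriticalPhenomena-4575 --as helper`).  Prequel: `PyrochloreSignQuasiChart` (p4 gen 20:
the model `PyroZ3.sites/graph`, inversions `invIso`, fcc frames `shiftIso` with FOUR base vertices `base`, and the ROTATED chart `(p₀+p₁, p₀−p₁)` — Sign-complete
at scale `N = 2` with 2-path quasi-steps).

THIS FILE (the other placement of the same net, P4 §41.5 (N±) made kernel): with the unrotated chart **`uchart p = (p₀, p₁)`**
* §1 `uchart` is sup-norm 1-Lipschitz along bonds (`ulip`);
* §2 **every one of the four unit steps `±e₀, ±e₁` is a SINGLE bond at every site** (`ustep_base`: 16 explicit bonds; `ustep` by the frames);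
* §3 the inversion through every site acts by `−I` on `uchart` (`exists_uneg`);
* §4 **the z-glide `q ↦ (q₀+1, q₁+1, −q₂)` is an automorphism (`glideIso`) acting on `uchart` by the TRANSLATION `(1,1)`** and carrying `base 0 ↦ base 3`,
  `base 2 ↦ base 1 − (−2,0,2)`; hence **`exists_frame₂`: every site is the image of `base 0 = (0,0,0)` or `base 2 = (1,0,1)` under a chart-TRANSLATING
  automorphism** — TWO frame types (not four), each carrying `−I`: exactly the interface of the multi-type `{±1}` node with `|types| = 2`, except for
  (κ) (cylinder connectivity), which is not typed here.  (No `{±I, ±swap}`-twisted frame merges the two types: P4 §43.2b; numerics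
  `HOME/prim-bschramm-p4-g21/lean/pyro_unit_chart.py`.)
[cite: ConwaySloane1999, Ch. 4 §6.1] [cite: KozmaNitzan2024, §4 p. 15 (outward steps), p. 16 (Lemma 8)]
-/

noncomputable section

namespace Summit.CriticalPhenomena.PercolationContinuityZ3.Theorems.Transplant

open SimpleGraph Literature.Probability.LatticeModels Literature.Probability.Percolation
open scoped Classical

namespace PyroZ3

/-! ## §1 The unrotated chart `(p₀, p₁)` is 1-Lipschitz -/

/-- The unrotated chart `p ↦ (p₀, p₁)`. [cite: KozmaNitzan2024, §4 p. 15 (the coordinate map)] -/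
def uchart (p : Site 3) : Site 2 := ![p 0, p 1]

/-- `uchart` is additive. [folklore] -/
theorem uchart_add (x u : Site 3) : uchart (x + u) = uchart x + uchart u := by
  funext j; fin_cases j <;> simp [uchart]

/-- **`uchart` is sup-norm 1-Lipschitz along bonds** (bond vectors have entries in `{−1,0,1}`). [cite: KozmaNitzan2024, §4 p. 15] -/
theorem ulip {x y : Site 3} (h : graph.Adj x y) (j : Fin 2) : |uchart x j - uchart y j| ≤ 1 := by
  obtain ⟨-, -, hv⟩ := (adj_iff x y).1 h
  obtain ⟨b0, b1, -, -⟩ := (mem_V12_iff _).1 hv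
  fin_cases j
  · show |x 0 - y 0| ≤ 1
    rw [abs_sub_comm]; simpa using b0
  · show |x 1 - y 1| ≤ 1
    rw [abs_sub_comm]; simpa using b1

/-- **Degree bound `≤ 12`** (the neighbours of `x` lie in `x + V12`). [folklore] -/
theorem degree_le_twelve (x : Site 3) : graph.degree x ≤ 12 := by
  rw [← card_neighborFinset_eq_degree]
  calc (graph.neighborFinset x).card ≤ (V12.image (x + ·)).card :=
        Finset.card_le_card fun v hv => by
          have h := neighborSet_subset x ((mem_neighborFinset _ _ _).1 hv)
          exact Finset.mem_coe.1 h
    _ ≤ V12.card := Finset.card_image_le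
    _ = 12 := by rfl

/-! ## §2 Unit steps along SINGLE bonds -/

/-- **Unit steps at the four base vertices**: 16 explicit bonds. [cite: KozmaNitzan2024, §4 p. 15 (outward steps)] -/
theorem ustep_base (c : Fin 4) (j : Fin 2) (σ : ℤˣ) : ∃ y : Site 3, graph.Adj (base c) y ∧ uchart y = uchart (base c) + Pi.single j (σ : ℤ) := by
  fin_cases c <;> fin_cases j <;> rcases Int.units_eq_one_or σ with rfl | rfl
  -- base 0 = (0,0,0): (1,0,1), (-1,0,-1), (0,1,1), (0,-1,-1)
  · exact ⟨![1, 0, 1], adj_of _ _ (by decide) (by decide) (by decide), by decide⟩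
  · exact ⟨![-1, 0, -1], adj_of _ _ (by decide) (by decide) (by decide), by decide⟩
  · exact ⟨![0, 1, 1], adj_of _ _ (by decide) (by decide) (by decide), by decide⟩
  · exact ⟨![0, -1, -1], adj_of _ _ (by decide) (by decide) (by decide), by decide⟩
  -- base 1 = (0,1,1): (1,1,0), (-1,1,2), (0,2,2), (0,0,0)
  · exact ⟨![1, 1, 0], adj_of _ _ (by decide) (by decide) (by decide), by decide⟩
  · exact ⟨![-1, 1, 2], adj_of _ _ (by decide) (by decide) (by decide), by decide⟩
  · exact ⟨![0, 2, 2], adj_of _ _ (by decide) (by decide) (by decide), by decide⟩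
  · exact ⟨![0, 0, 0], adj_of _ _ (by decide) (by decide) (by decide), by decide⟩
  -- base 2 = (1,0,1): (2,0,2), (0,0,0), (1,1,0), (1,-1,2)
  · exact ⟨![2, 0, 2], adj_of _ _ (by decide) (by decide) (by decide), by decide⟩
  · exact ⟨![0, 0, 0], adj_of _ _ (by decide) (by decide) (by decide), by decide⟩
  · exact ⟨![1, 1, 0], adj_of _ _ (by decide) (by decide) (by decide), by decide⟩
  · exact ⟨![1, -1, 2], adj_of _ _ (by decide) (by decide) (by decide), by decide⟩
  -- base 3 = (1,1,0): (2,1,-1), (0,1,1), (1,2,-1), (1,0,1)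
  · exact ⟨![2, 1, -1], adj_of _ _ (by decide) (by decide) (by decide), by decide⟩
  · exact ⟨![0, 1, 1], adj_of _ _ (by decide) (by decide) (by decide), by decide⟩
  · exact ⟨![1, 2, -1], adj_of _ _ (by decide) (by decide) (by decide), by decide⟩
  · exact ⟨![1, 0, 1], adj_of _ _ (by decide) (by decide) (by decide), by decide⟩

/-- **UNIT STEPS ALONG SINGLE BONDS AT EVERY SITE** (transport of `ustep_base` by the fcc frames). [cite: KozmaNitzan2024, §4 p. 15 (outward steps)] -/
theorem ustep (x : Site 3) (hx : x ∈ sites) (j : Fin 2) (σ : ℤˣ) : ∃ y : Site 3, graph.Adj x y ∧ uchart y = uchart x + Pi.single j (σ : ℤ) := by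
  obtain ⟨c, w, hw, hxe⟩ := exists_frame x hx
  obtain ⟨y, h1, h2⟩ := ustep_base c j σ
  refine ⟨y + w, ?_, ?_⟩
  · have h := (shiftIso w hw).map_rel_iff.2 h1
    rwa [hxe, shiftIso_apply] at h
  · rw [← hxe, shiftIso_apply, uchart_add, uchart_add, h2]; abel

/-! ## §3 `−I` at every site for the unrotated chart -/

/-- **`−I` at every point of even coordinate sum** (in particular at every site), for `uchart`. [cite: KozmaNitzan2024, §4 p. 16 (Lemma 8)] -/
theorem exists_uneg (c : Site 3) (hc : (c 0 + c 1 + c 2) % 2 = 0) :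
    ∃ α : graph ≃g graph, (∀ w, w ∈ sites ↔ α w ∈ sites) ∧ α c = c ∧ ∀ w, uchart (α w) - uchart c = -(uchart w - uchart c) := by
  refine ⟨invIso c hc, fun w => (mem_sites_inv hc w).symm, by funext i; show 2 * c i - c i = c i; ring, fun w => ?_⟩
  show uchart (inv c w) - uchart c = -(uchart w - uchart c)
  funext j; fin_cases j <;> simp [uchart, inv] <;> ring

/-- `−I` at every SITE. [cite: KozmaNitzan2024, §4 p. 16 (Lemma 8)] -/
theorem exists_uneg_site (c : Site 3) (hc : c ∈ sites) :
    ∃ α : graph ≃g graph, (∀ w, w ∈ sites ↔ α w ∈ sites) ∧ α c = c ∧ ∀ w, uchart (α w) - uchart c = -(uchart w - uchart c) :=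
  exists_uneg c (sum_even_of_mem_sites hc)

/-! ## §4 The z-glide: an automorphism translating the chart; TWO frame types -/

/-- The z-glide `q ↦ (q₀ + 1, q₁ + 1, −q₂)`. [cite: ConwaySloane1999, Ch. 4 §6.1] -/
def glide (q : Site 3) : Site 3 := ![q 0 + 1, q 1 + 1, -q 2]

/-- Its inverse `q ↦ (q₀ − 1, q₁ − 1, −q₂)`. [folklore] -/
def glideInv (q : Site 3) : Site 3 := ![q 0 - 1, q 1 - 1, -q 2]

/-- The glide preserves the site set. [folklore] -/
theorem mem_sites_glide (q : Site 3) : glide q ∈ sites ↔ q ∈ sites := by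
  simp only [sites, Set.mem_setOf_eq, glide]
  simp only [Matrix.cons_val_zero, Matrix.cons_val_one, Matrix.cons_val]
  omega

/-- Negating the last coordinate preserves `V12`. [folklore] -/
theorem zneg_mem_V12_iff (v : Site 3) : (![v 0, v 1, -v 2] : Site 3) ∈ V12 ↔ v ∈ V12 := by
  rw [mem_V12_iff, mem_V12_iff]; simp [abs_neg]

/-- **The z-glide is an automorphism of the pyrochlore net.** [cite: ConwaySloane1999, Ch. 4 §6.1] -/
def glideIso : graph ≃g graph where
  toFun := glide
  invFun := glideInv
  left_inv q := by funext i; fin_cases i <;> simp [glide, glideInv]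
  right_inv q := by funext i; fin_cases i <;> simp [glide, glideInv]
  map_rel_iff' := by
    intro x y
    have e : glide y - glide x = ![(y - x) 0, (y - x) 1, -(y - x) 2] := by
      funext i; fin_cases i <;> simp [glide, sub_eq_add_neg, add_comm, add_left_comm, add_assoc, neg_add_rev]
    simp only [Equiv.coe_fn_mk, adj_iff, mem_sites_glide, e, zneg_mem_V12_iff]

/-- `glideIso q = glide q`. [folklore] -/
@[simp] theorem glideIso_apply (q : Site 3) : glideIso q = glide q := rfl

/-- **The glide TRANSLATES the unrotated chart** by `(1,1)`. [folklore] -/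
theorem uchart_glide (q : Site 3) : uchart (glide q) = uchart q + ![1, 1] := by
  funext j; fin_cases j <;> simp [uchart, glide]

/-- The two base vertices `(0,0,0)` and `(1,0,1)`. [folklore] -/
def base₂ : Fin 2 → Site 3 := ![![0, 0, 0], ![1, 0, 1]]

/-- The two base vertices are sites. [folklore] -/
theorem base₂_mem_sites : ∀ c : Fin 2, base₂ c ∈ sites := by decide

/-- **TWO FRAME TYPES: every site is the image of `(0,0,0)` or of `(1,0,1)` under an automorphism translating `uchart`** (fcc translations, composed
with the z-glide for the other two fcc classes). [cite: KozmaNitzan2024, §4 p. 16 (Lemma 8)] -/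
theorem exists_frame₂ (x : Site 3) (hx : x ∈ sites) :
    ∃ (c : Fin 2) (α : graph ≃g graph), (∀ w, w ∈ sites ↔ α w ∈ sites) ∧ α (base₂ c) = x ∧
      ∀ w, uchart (α w) = uchart w + (uchart x - uchart (base₂ c)) := by
  obtain ⟨c, w, hw, hxe⟩ := exists_frame x hx
  have hshift : ∀ (c' : Fin 2) (w' : Site 3) (hw' : w' ∈ frameVecs), shiftIso w' hw' (base₂ c') = x →
      ∃ (c : Fin 2) (α : graph ≃g graph), (∀ w, w ∈ sites ↔ α w ∈ sites) ∧ α (base₂ c) = x ∧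
        ∀ u, uchart (α u) = uchart u + (uchart x - uchart (base₂ c)) := by
    intro c' w' hw' he
    refine ⟨c', shiftIso w' hw', fun u => (mem_sites_add hw' u).symm, he, fun u => ?_⟩
    rw [← he, shiftIso_apply, shiftIso_apply, uchart_add, uchart_add]; abel
  have hglide : ∀ (c' : Fin 2) (w' : Site 3) (hw' : w' ∈ frameVecs), shiftIso w' hw' (glide (base₂ c')) = x →
      ∃ (c : Fin 2) (α : graph ≃g graph), (∀ w, w ∈ sites ↔ α w ∈ sites) ∧ α (base₂ c) = x ∧
        ∀ u, uchart (α u) = uchart u + (uchart x - uchart (base₂ c)) := by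
    intro c' w' hw' he
    refine ⟨c', glideIso.trans (shiftIso w' hw'), fun u => ?_, he, fun u => ?_⟩
    · show u ∈ sites ↔ glide u + w' ∈ sites
      rw [mem_sites_add hw', mem_sites_glide]
    · show uchart (glide u + w') = uchart u + (uchart x - uchart (base₂ c'))
      rw [← he, shiftIso_apply, uchart_add, uchart_add, uchart_glide, uchart_glide]; abel
  fin_cases c
  · -- base 0 = base₂ 0
    exact hshift 0 w hw hxe
  · -- base 1 = (0,1,1) = glide (base₂ 1) + (-2,0,2)
    have hw' : w + ![-2, 0, 2] ∈ frameVecs := by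
      obtain ⟨h0, h1, h2, hs⟩ := hw
      refine ⟨?_, ?_, ?_, ?_⟩ <;> simp <;> omega
    refine hglide 1 (w + ![-2, 0, 2]) hw' ?_
    have key : glide (base₂ 1) + ![-2, 0, 2] = base 1 := by decide
    rw [← hxe, shiftIso_apply, shiftIso_apply, add_comm w, ← add_assoc, key]
    rfl
  · -- base 2 = base₂ 1
    exact hshift 1 w hw hxe
  · -- base 3 = (1,1,0) = glide (base₂ 0)
    refine hglide 0 w hw ?_
    have key : glide (base₂ 0) = base 3 := by decide
    rw [← hxe, shiftIso_apply, shiftIso_apply, key]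
    rfl

/-- **The glide halves the types but is NOT a point symmetry**: it fixes no site (it moves `uchart` by `(1,1)`). [folklore] -/
theorem glide_ne_self (q : Site 3) : glide q ≠ q := by
  intro h
  have := congrFun h 0
  simp [glide] at this

end PyroZ3

end Summit.CriticalPhenomena.PercolationContinuityZ3.Theorems.Transplant

end
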